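import Summits.NavierStokesRegularity.NavierStokesRegularity.Theorems.ExtremiserTransienceTwoThirdsRemainderBound
import Summits.NavierStokesRegularity.NavierStokesRegularity.Theorems.ExtremiserTransienceTwoThirdsGaugeL2Package
import HarnessLib

/-!
# Route `ExtremiserTransience`, crux `NearExtremalTransiencePerFlow` (stmt-NavierStokesRegularity-26567), LINE g10-1 «two_thirds»
# (ns-idea-10 g10), stub S2 `FirstOrderIdentity`: the LAYER INTEGRAL is `C·η-layer bulk + O(1/ρ)(1 + bulk(4R))`

Helper file for S2 (`--supports stmt-NavierStokesRegularity-26567`).  With `R = ρ⁸`, `ℓ = ρ⁷`, the truncated Biot–Savart gauge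
`ψ = K ∗ (ζV)` and a thin-shell weight `χ` (`0 ≤ χ ≤ 1`, `χ = 0` near every point off `B(c,R+ℓ)`, `‖Dʲχ‖ ≤ j!Kⱼ/ℓʲ` on the layer
`Λ = B(c,R+ℓ) ∖ B(c,R)`), the layer integral of the reduction identity (`three_Jg_sub_two_Kg_eq`, `P = B(c,R)`) obeys

  `|∫_{B(c,R)ᶜ} (f₁(φ₀) + χ²(3·sd − κ⋆(zd+wd)))| ≤ 11K³Θ₀·((Z_{B(c,R+ℓ)} − Z_{B(c,R)}) + (W_{B(c,R+ℓ)} − W_{B(c,R)}))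
      + C·(1 + Z_{B(c,4R)})/ρ`

(`layer_bound`), `K = max(1, A₁, κ⋆, ‖curlCLM‖)`, `Θ₀ = 1 + K₁ + (K₁ + 2K₂) + (2K₂ + 6K₃)`, `C` depending only on
`K, K₁, K₂, K₃, C₀, A_E` and the universal `L²` constant of `gauge_L2`: the integrated layer estimate (`setIntegral_abs_layerIntegrand_le`
with weights `s = ρ⁻⁴`, `t = ρ⁻¹³`), the `L²` sizes of the gauge (`gauge_L2`, linear growth, the logarithmic sup bound with
`K + 1 ≤ 19ρ`) and the layer volume `≤ (32π/3)R³`.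

HONEST FRAMING: bookkeeping; nothing about Navier–Stokes regularity or blow-up is proved; S2, the crux ⟨26567⟩ and NS regularity are
OPEN; no summit is proved by a line. [folklore]
-/

noncomputable section

open scoped Topology InnerProductSpace RealInnerProductSpace ENNReal ContDiff
open MeasureTheory Filter Set Metric
open Literature.Analysis.FluidPDE
open Summit.NavierStokesRegularity.NavierStokesRegularity.Theorems.DepletionLadder.KStar.HalfSpace
open Summit.NavierStokesRegularity.NavierStokesRegularity.Theorems.DepletionLadder
open Summit.NavierStokesRegularity.NavierStokesRegularity.Theorems.NearExtremalTransiencePerFlow.LocalMaximiser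

namespace Summit.NavierStokesRegularity.NavierStokesRegularity.Theorems.NearExtremalTransiencePerFlow.TwoThirds

-- the summit's namespace repeats the problem name by convention (D-0017)
set_option linter.dupNamespace false

variable {V : E3 → E3}

/-- The first-variation density vanishes at a point near which the direction vanishes identically. [folklore] -/
theorem f1_eq_zero_of_eventuallyEq_zero {φ : E3 → E3} {x : E3} (h : φ =ᶠ[𝓝 x] fun _ => (0 : E3)) : f1 V φ x = 0 := by
  have hcurl : ∀ y, φ =ᶠ[𝓝 y] (fun _ => (0 : E3)) → curl φ y = 0 := fun y hy => by
    have e : curl φ y = curl (fun _ => (0 : E3)) y := by simp only [curl, hy.fderiv_eq]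
    rw [e, curl_fun_zero]
  have h1 : curl φ x = 0 := hcurl x h
  have h2 : fderiv ℝ φ x = 0 := by rw [h.fderiv_eq, fderiv_const_apply]
  have h3 : fderiv ℝ (curl φ) x = 0 := by
    have hev : curl φ =ᶠ[𝓝 x] fun _ => (0 : E3) := by
      filter_upwards [h.eventuallyEq_nhds] with y hy
      exact hcurl y hy
    rw [hev.fderiv_eq, fderiv_const_apply]
  unfold f1 c1 z1 w1
  rw [h1, h2, h3]
  simp

/-- A dyadic exponent adapted to `R = ρ⁸`: `5ρ⁸ ≤ 2^{K+1}` with `K + 1 ≤ 19ρ` (`K + 1 = 8⌈ρ⌉ + 3`). [folklore] -/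
theorem exists_dyadic_exponent {ρ : ℝ} (hρ : 1 ≤ ρ) : ∃ K : ℕ, 5 * ρ ^ 8 ≤ (2 : ℝ) ^ (K + 1) ∧ ((K : ℝ) + 1) ≤ 19 * ρ := by
  have hρ0 : 0 ≤ ρ := le_trans zero_le_one hρ
  set m : ℕ := ⌈ρ⌉₊ with hm
  have hm1 : ρ ≤ (m : ℝ) := Nat.le_ceil ρ
  have hm2 : (m : ℝ) < ρ + 1 := Nat.ceil_lt_add_one hρ0
  refine ⟨8 * m + 2, ?_, ?_⟩
  · have h2m : (m : ℝ) ≤ (2 : ℝ) ^ m := by exact_mod_cast (Nat.lt_two_pow_self (n := m)).le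
    have hpow : ρ ^ 8 ≤ ((2 : ℝ) ^ m) ^ 8 := pow_le_pow_left₀ hρ0 (hm1.trans h2m) 8
    have e : (2 : ℝ) ^ (8 * m + 2 + 1) = 8 * ((2 : ℝ) ^ m) ^ 8 := by
      rw [← pow_mul, show 8 * m + 2 + 1 = m * 8 + 3 by ring, pow_add]; norm_num; ring
    rw [e]
    linarith only [hpow, pow_nonneg hρ0 8]
  · push_cast
    linarith

/-- The arithmetic of the layer bound (see `layer_bound`). [folklore] -/
theorem layer_arith {ρ K K₁ K₂ K₃ A_E C_L C₀ Ψ₁ ZΛ WΛ NV NDψ Nψ NDV ND2ψ Z4 : ℝ} (hρ : 2 ≤ ρ) (hK : 1 ≤ K)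
    (hK₁ : 0 ≤ K₁) (hK₂ : 0 ≤ K₂) (hK₃ : 0 ≤ K₃) (hAE : 0 ≤ A_E) (hCL : 0 ≤ C_L)
    (hZ : 0 ≤ ZΛ) (hW : 0 ≤ WΛ) (hZ4 : 0 ≤ Z4)
    (hNV : NV ≤ A_E * (ρ ^ 8 + ρ ^ 7)) (hNDψ : NDψ ≤ C_L * A_E * ρ ^ 8) (hNψ : Nψ ≤ (Ψ₁ * ρ) ^ 2 * (32 * Real.pi / 3 * (ρ ^ 8) ^ 3))
    (hNDV : NDV ≤ C_L * (Z4 + C₀ ^ 2 * A_E / ρ ^ 8)) (hND2ψ : ND2ψ ≤ C_L * (C_L * (Z4 + C₀ ^ 2 * A_E / ρ ^ 8))) :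
    11 * K ^ 3 * ((1 + K₁ / ρ ^ 7 + (K₁ / ρ ^ 7 + 2 * K₂ / (ρ ^ 7) ^ 2) / (ρ ^ 4)⁻¹ +
        (2 * K₂ / (ρ ^ 7) ^ 2 + 6 * K₃ / (ρ ^ 7) ^ 3) / (ρ ^ 13)⁻¹) * (ZΛ + WΛ) +
      (ρ ^ 4)⁻¹ * (K₁ / ρ ^ 7 + 2 * K₂ / (ρ ^ 7) ^ 2) * (NV + NDψ) +
      (ρ ^ 13)⁻¹ * (2 * K₂ / (ρ ^ 7) ^ 2 + 6 * K₃ / (ρ ^ 7) ^ 3) * Nψ + K₁ / ρ ^ 7 * (NDV + ND2ψ)) ≤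
    11 * K ^ 3 * (1 + K₁ + (K₁ + 2 * K₂) + (2 * K₂ + 6 * K₃)) * (ZΛ + WΛ) +
    11 * K ^ 3 * ((K₁ + 2 * K₂) * (2 + C_L) * A_E + (2 * K₂ + 6 * K₃) * (32 * Real.pi / 3) * Ψ₁ ^ 2 +
      K₁ * (C_L + C_L ^ 2) * (1 + C₀ ^ 2 * A_E)) * (1 + Z4) / ρ := by
  have hρ0 : 0 < ρ := by linarith
  have hρ1 : 1 ≤ ρ := by linarith
  have hK0 : 0 ≤ K := le_trans zero_le_one hK
  have hK3 : 0 ≤ 11 * K ^ 3 := by positivity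
  have hp : ∀ {m n : ℕ}, m ≤ n → (ρ ^ n)⁻¹ ≤ (ρ ^ m)⁻¹ := fun hmn =>
    inv_anti₀ (by positivity) (pow_le_pow_right₀ hρ1 hmn)
  have hp1 : ∀ n : ℕ, (ρ ^ n)⁻¹ ≤ 1 := fun n => inv_le_one_of_one_le₀ (one_le_pow₀ hρ1)
  have hρi : 0 ≤ ρ⁻¹ := by positivity
  -- (i) the `η`-coefficient
  have hΘ : 1 + K₁ / ρ ^ 7 + (K₁ / ρ ^ 7 + 2 * K₂ / (ρ ^ 7) ^ 2) / (ρ ^ 4)⁻¹ +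
      (2 * K₂ / (ρ ^ 7) ^ 2 + 6 * K₃ / (ρ ^ 7) ^ 3) / (ρ ^ 13)⁻¹ ≤ 1 + K₁ + (K₁ + 2 * K₂) + (2 * K₂ + 6 * K₃) := by
    have e : 1 + K₁ / ρ ^ 7 + (K₁ / ρ ^ 7 + 2 * K₂ / (ρ ^ 7) ^ 2) / (ρ ^ 4)⁻¹ +
        (2 * K₂ / (ρ ^ 7) ^ 2 + 6 * K₃ / (ρ ^ 7) ^ 3) / (ρ ^ 13)⁻¹ =
        1 + K₁ * (ρ ^ 7)⁻¹ + (K₁ * (ρ ^ 3)⁻¹ + 2 * K₂ * (ρ ^ 10)⁻¹) + (2 * K₂ * (ρ ^ 1)⁻¹ + 6 * K₃ * (ρ ^ 8)⁻¹) := by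
      field_simp
    rw [e]
    have u1 := mul_le_mul_of_nonneg_left (hp1 7) hK₁
    have u2 := mul_le_mul_of_nonneg_left (hp1 3) hK₁
    have u3 := mul_le_mul_of_nonneg_left (hp1 10) (by positivity : 0 ≤ 2 * K₂)
    have u4 := mul_le_mul_of_nonneg_left (hp1 1) (by positivity : 0 ≤ 2 * K₂)
    have u5 := mul_le_mul_of_nonneg_left (hp1 8) (by positivity : 0 ≤ 6 * K₃)
    linarith only [u1, u2, u3, u4, u5]
  have T0 : 11 * K ^ 3 * ((1 + K₁ / ρ ^ 7 + (K₁ / ρ ^ 7 + 2 * K₂ / (ρ ^ 7) ^ 2) / (ρ ^ 4)⁻¹ +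
      (2 * K₂ / (ρ ^ 7) ^ 2 + 6 * K₃ / (ρ ^ 7) ^ 3) / (ρ ^ 13)⁻¹) * (ZΛ + WΛ)) ≤
      11 * K ^ 3 * (1 + K₁ + (K₁ + 2 * K₂) + (2 * K₂ + 6 * K₃)) * (ZΛ + WΛ) := by
    rw [mul_assoc (11 * K ^ 3)]
    exact mul_le_mul_of_nonneg_left (mul_le_mul_of_nonneg_right hΘ (by positivity)) hK3
  -- (ii) the `V, Dψ` terms
  have T1 : (ρ ^ 4)⁻¹ * (K₁ / ρ ^ 7 + 2 * K₂ / (ρ ^ 7) ^ 2) * (NV + NDψ) ≤ (K₁ + 2 * K₂) * (2 + C_L) * A_E * ρ⁻¹ := by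
    have e : (ρ ^ 4)⁻¹ * (K₁ / ρ ^ 7 + 2 * K₂ / (ρ ^ 7) ^ 2) = K₁ * (ρ ^ 11)⁻¹ + 2 * K₂ * (ρ ^ 18)⁻¹ := by field_simp
    have ha : K₁ * (ρ ^ 11)⁻¹ + 2 * K₂ * (ρ ^ 18)⁻¹ ≤ (K₁ + 2 * K₂) * (ρ ^ 11)⁻¹ := by
      have := mul_le_mul_of_nonneg_left (hp (m := 11) (n := 18) (by norm_num)) (by positivity : 0 ≤ 2 * K₂)
      linarith only [this]
    have hN : NV + NDψ ≤ (2 + C_L) * A_E * ρ ^ 8 := by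
      have h7 : ρ ^ 7 ≤ ρ ^ 8 := pow_le_pow_right₀ hρ1 (by norm_num)
      have h8 := mul_le_mul_of_nonneg_left h7 hAE
      linarith only [hNV, hNDψ, h8]
    have hN0 : 0 ≤ NV + NDψ ∨ NV + NDψ < 0 := le_or_gt 0 _
    have hcoef0 : 0 ≤ (ρ ^ 4)⁻¹ * (K₁ / ρ ^ 7 + 2 * K₂ / (ρ ^ 7) ^ 2) := by positivity
    rcases hN0 with hN0 | hN0
    · have s1 : (ρ ^ 4)⁻¹ * (K₁ / ρ ^ 7 + 2 * K₂ / (ρ ^ 7) ^ 2) * (NV + NDψ) ≤ (K₁ + 2 * K₂) * (ρ ^ 11)⁻¹ * ((2 + C_L) * A_E * ρ ^ 8) := by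
        rw [e]; exact mul_le_mul ha hN hN0 (by positivity)
      have e2 : (K₁ + 2 * K₂) * (ρ ^ 11)⁻¹ * ((2 + C_L) * A_E * ρ ^ 8) = (K₁ + 2 * K₂) * (2 + C_L) * A_E * (ρ ^ 3)⁻¹ := by
        field_simp
      have s2 : (K₁ + 2 * K₂) * (2 + C_L) * A_E * (ρ ^ 3)⁻¹ ≤ (K₁ + 2 * K₂) * (2 + C_L) * A_E * ρ⁻¹ :=
        mul_le_mul_of_nonneg_left (by simpa using hp (m := 1) (n := 3) (by norm_num)) (by positivity)
      linarith only [s1, e2, s2]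
    · have s1 : (ρ ^ 4)⁻¹ * (K₁ / ρ ^ 7 + 2 * K₂ / (ρ ^ 7) ^ 2) * (NV + NDψ) ≤ 0 :=
        mul_nonpos_of_nonneg_of_nonpos hcoef0 hN0.le
      have s2 : 0 ≤ (K₁ + 2 * K₂) * (2 + C_L) * A_E * ρ⁻¹ := by positivity
      linarith only [s1, s2]
  -- (iii) the `ψ` term
  have T2 : (ρ ^ 13)⁻¹ * (2 * K₂ / (ρ ^ 7) ^ 2 + 6 * K₃ / (ρ ^ 7) ^ 3) * Nψ ≤ (2 * K₂ + 6 * K₃) * (32 * Real.pi / 3) * Ψ₁ ^ 2 * ρ⁻¹ := by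
    have e : (ρ ^ 13)⁻¹ * (2 * K₂ / (ρ ^ 7) ^ 2 + 6 * K₃ / (ρ ^ 7) ^ 3) = 2 * K₂ * (ρ ^ 27)⁻¹ + 6 * K₃ * (ρ ^ 34)⁻¹ := by field_simp
    have ha : 2 * K₂ * (ρ ^ 27)⁻¹ + 6 * K₃ * (ρ ^ 34)⁻¹ ≤ (2 * K₂ + 6 * K₃) * (ρ ^ 27)⁻¹ := by
      have := mul_le_mul_of_nonneg_left (hp (m := 27) (n := 34) (by norm_num)) (by positivity : 0 ≤ 6 * K₃)
      linarith only [this]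
    have hcoef0 : 0 ≤ (ρ ^ 13)⁻¹ * (2 * K₂ / (ρ ^ 7) ^ 2 + 6 * K₃ / (ρ ^ 7) ^ 3) := by positivity
    rcases le_or_gt 0 Nψ with hN0 | hN0
    · have s1 : (ρ ^ 13)⁻¹ * (2 * K₂ / (ρ ^ 7) ^ 2 + 6 * K₃ / (ρ ^ 7) ^ 3) * Nψ ≤
          (2 * K₂ + 6 * K₃) * (ρ ^ 27)⁻¹ * ((Ψ₁ * ρ) ^ 2 * (32 * Real.pi / 3 * (ρ ^ 8) ^ 3)) := by
        rw [e]; exact mul_le_mul ha hNψ hN0 (by positivity)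
      have e2 : (2 * K₂ + 6 * K₃) * (ρ ^ 27)⁻¹ * ((Ψ₁ * ρ) ^ 2 * (32 * Real.pi / 3 * (ρ ^ 8) ^ 3)) =
          (2 * K₂ + 6 * K₃) * (32 * Real.pi / 3) * Ψ₁ ^ 2 * ρ⁻¹ := by field_simp
      linarith only [s1, e2]
    · have s1 : (ρ ^ 13)⁻¹ * (2 * K₂ / (ρ ^ 7) ^ 2 + 6 * K₃ / (ρ ^ 7) ^ 3) * Nψ ≤ 0 := mul_nonpos_of_nonneg_of_nonpos hcoef0 hN0.le
      have s2 : 0 ≤ (2 * K₂ + 6 * K₃) * (32 * Real.pi / 3) * Ψ₁ ^ 2 * ρ⁻¹ := by positivity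
      linarith only [s1, s2]
  -- (iv) the `DV, D²ψ` terms
  have T3 : K₁ / ρ ^ 7 * (NDV + ND2ψ) ≤ K₁ * (C_L + C_L ^ 2) * (1 + C₀ ^ 2 * A_E) * (1 + Z4) * ρ⁻¹ := by
    have hq : Z4 + C₀ ^ 2 * A_E / ρ ^ 8 ≤ (1 + C₀ ^ 2 * A_E) * (1 + Z4) := by
      have u1 : C₀ ^ 2 * A_E / ρ ^ 8 ≤ C₀ ^ 2 * A_E := by
        rw [div_eq_mul_inv]; exact mul_le_of_le_one_right (by positivity) (hp1 8)
      have u2 := mul_nonneg (mul_nonneg (sq_nonneg C₀) hAE) hZ4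
      linarith only [u1, hZ4, u2]
    have hq0 : 0 ≤ Z4 + C₀ ^ 2 * A_E / ρ ^ 8 := by positivity
    have hN : NDV + ND2ψ ≤ (C_L + C_L ^ 2) * ((1 + C₀ ^ 2 * A_E) * (1 + Z4)) := by
      have u1 : C_L * (Z4 + C₀ ^ 2 * A_E / ρ ^ 8) ≤ C_L * ((1 + C₀ ^ 2 * A_E) * (1 + Z4)) := mul_le_mul_of_nonneg_left hq hCL
      have u2 : C_L * (C_L * (Z4 + C₀ ^ 2 * A_E / ρ ^ 8)) ≤ C_L * (C_L * ((1 + C₀ ^ 2 * A_E) * (1 + Z4))) :=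
        mul_le_mul_of_nonneg_left u1 hCL
      linarith only [hNDV, hND2ψ, u1, u2]
    have e : K₁ / ρ ^ 7 = K₁ * (ρ ^ 7)⁻¹ := div_eq_mul_inv _ _
    rcases le_or_gt 0 (NDV + ND2ψ) with hN0 | hN0
    · have s1 : K₁ / ρ ^ 7 * (NDV + ND2ψ) ≤ K₁ * ρ⁻¹ * ((C_L + C_L ^ 2) * ((1 + C₀ ^ 2 * A_E) * (1 + Z4))) := by
        rw [e]
        exact mul_le_mul (mul_le_mul_of_nonneg_left (by simpa using hp (m := 1) (n := 7) (by norm_num)) hK₁) hN hN0 (by positivity)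
      linarith only [s1]
    · have s1 : K₁ / ρ ^ 7 * (NDV + ND2ψ) ≤ 0 := mul_nonpos_of_nonneg_of_nonpos (by positivity) hN0.le
      have s2 : 0 ≤ K₁ * (C_L + C_L ^ 2) * (1 + C₀ ^ 2 * A_E) * (1 + Z4) * ρ⁻¹ := by positivity
      linarith only [s1, s2]
  -- assemble
  have hsum : (ρ ^ 4)⁻¹ * (K₁ / ρ ^ 7 + 2 * K₂ / (ρ ^ 7) ^ 2) * (NV + NDψ) +
      (ρ ^ 13)⁻¹ * (2 * K₂ / (ρ ^ 7) ^ 2 + 6 * K₃ / (ρ ^ 7) ^ 3) * Nψ + K₁ / ρ ^ 7 * (NDV + ND2ψ) ≤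
      ((K₁ + 2 * K₂) * (2 + C_L) * A_E + (2 * K₂ + 6 * K₃) * (32 * Real.pi / 3) * Ψ₁ ^ 2 +
        K₁ * (C_L + C_L ^ 2) * (1 + C₀ ^ 2 * A_E)) * (1 + Z4) * ρ⁻¹ := by
    have v1 : (K₁ + 2 * K₂) * (2 + C_L) * A_E * ρ⁻¹ ≤ (K₁ + 2 * K₂) * (2 + C_L) * A_E * (1 + Z4) * ρ⁻¹ := by
      have h1 : (K₁ + 2 * K₂) * (2 + C_L) * A_E ≤ (K₁ + 2 * K₂) * (2 + C_L) * A_E * (1 + Z4) :=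
        le_mul_of_one_le_right (by positivity) (by linarith)
      exact mul_le_mul_of_nonneg_right h1 hρi
    have v2 : (2 * K₂ + 6 * K₃) * (32 * Real.pi / 3) * Ψ₁ ^ 2 * ρ⁻¹ ≤ (2 * K₂ + 6 * K₃) * (32 * Real.pi / 3) * Ψ₁ ^ 2 * (1 + Z4) * ρ⁻¹ := by
      have h1 : (2 * K₂ + 6 * K₃) * (32 * Real.pi / 3) * Ψ₁ ^ 2 ≤ (2 * K₂ + 6 * K₃) * (32 * Real.pi / 3) * Ψ₁ ^ 2 * (1 + Z4) :=
        le_mul_of_one_le_right (by positivity) (by linarith)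
      exact mul_le_mul_of_nonneg_right h1 hρi
    linarith only [T1, T2, T3, v1, v2]
  have hfin := mul_le_mul_of_nonneg_left hsum hK3
  have e : 11 * K ^ 3 * ((K₁ + 2 * K₂) * (2 + C_L) * A_E + (2 * K₂ + 6 * K₃) * (32 * Real.pi / 3) * Ψ₁ ^ 2 +
      K₁ * (C_L + C_L ^ 2) * (1 + C₀ ^ 2 * A_E)) * (1 + Z4) / ρ =
      11 * K ^ 3 * (((K₁ + 2 * K₂) * (2 + C_L) * A_E + (2 * K₂ + 6 * K₃) * (32 * Real.pi / 3) * Ψ₁ ^ 2 +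
      K₁ * (C_L + C_L ^ 2) * (1 + C₀ ^ 2 * A_E)) * (1 + Z4) * ρ⁻¹) := by
    rw [div_eq_mul_inv]; ring
  linarith only [T0, hfin, e]

/-- **THE LAYER INTEGRAL IS `C·(layer bulk) + O(1/ρ)(1 + Z_{B(c,4R)})`** (see the module docstring). [folklore] -/
theorem layer_bound {A₁ K₁ K₂ K₃ C₀ A_E : ℝ} (hK₁ : 0 ≤ K₁) (hK₂ : 0 ≤ K₂) (hK₃ : 0 ≤ K₃) (hC₀0 : 0 ≤ C₀)
    (hAE : 0 ≤ A_E) :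
    ∃ C : ℝ, 0 ≤ C ∧ ∀ (V : E3 → E3) (c : E3) (ρ : ℝ) (χ : E3 → ℝ),
      ContDiff ℝ (⊤ : ℕ∞) V → VectorCalculus.IsDivFree V → (∀ x, ‖V x‖ ≤ 1) → HasLinearGrowth A_E V →
      (∀ x, ‖fderiv ℝ V x‖ ≤ A₁) → 2 ≤ ρ → (∀ y, ‖fderiv ℝ (ballCutoff c (ρ ^ 8)) y‖ ≤ C₀ / ρ ^ 8) →
      ContDiff ℝ (⊤ : ℕ∞) χ → (∀ x, 0 ≤ χ x ∧ χ x ≤ 1) → (∀ x, ρ ^ 8 + ρ ^ 7 ≤ ‖x - c‖ → χ =ᶠ[𝓝 x] fun _ => 0) →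
      (∀ x ∈ ball c (ρ ^ 8 + ρ ^ 7) \ ball c (ρ ^ 8), ‖fderiv ℝ χ x‖ ≤ K₁ / ρ ^ 7) →
      (∀ x ∈ ball c (ρ ^ 8 + ρ ^ 7) \ ball c (ρ ^ 8), ‖iteratedFDeriv ℝ 2 χ x‖ ≤ 2 * K₂ / (ρ ^ 7) ^ 2) →
      (∀ x ∈ ball c (ρ ^ 8 + ρ ^ 7) \ ball c (ρ ^ 8), ‖iteratedFDeriv ℝ 3 χ x‖ ≤ 6 * K₃ / (ρ ^ 7) ^ 3) →
      |∫ x in (ball c (ρ ^ 8))ᶜ,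
          (f1 V (fun y => χ y • curl (biotSavart fun y => ballCutoff c (ρ ^ 8) y • V y) y - χ y • V y -
              curl (fun z => χ z • biotSavart (fun y => ballCutoff c (ρ ^ 8) y • V y) z) y) x +
            χ x ^ 2 * (3 * sd V x - kStar * (zd V x + wd V x)))| ≤
        11 * (max (max 1 A₁) (max kStar ‖curlCLM‖)) ^ 3 * (1 + K₁ + (K₁ + 2 * K₂) + (2 * K₂ + 6 * K₃)) *
            ((Zb V c (ρ ^ 8 + ρ ^ 7) - Zb V c (ρ ^ 8)) + (Wb V c (ρ ^ 8 + ρ ^ 7) - Wb V c (ρ ^ 8))) +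
          C * (1 + Zb V c (4 * ρ ^ 8)) / ρ := by
  obtain ⟨C_L, hCL0, hCL⟩ := gauge_L2
  set Kb : ℝ := max (max 1 A₁) (max kStar ‖curlCLM‖) with hKb
  have hKb1 : 1 ≤ Kb := le_trans (le_max_left _ _) (le_max_left _ _)
  have hKbA : A₁ ≤ Kb := le_trans (le_max_right _ _) (le_max_left _ _)
  have hKbκ : kStar ≤ Kb := le_trans (le_max_left _ _) (le_max_right _ _)
  have hKbc : ‖curlCLM‖ ≤ Kb := le_trans (le_max_right _ _) (le_max_right _ _)
  have hKb0 : 0 ≤ Kb := le_trans zero_le_one hKb1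
  set Ψ₁ : ℝ := 1 + 19 * ((A_E + 4 * Real.pi / 3) / (2 * Real.pi)) with hΨ₁
  have hΨ₁0 : 0 ≤ Ψ₁ := by positivity
  refine ⟨11 * Kb ^ 3 * ((K₁ + 2 * K₂) * (2 + C_L) * A_E + (2 * K₂ + 6 * K₃) * (32 * Real.pi / 3) * Ψ₁ ^ 2 +
      K₁ * (C_L + C_L ^ 2) * (1 + C₀ ^ 2 * A_E)), by positivity, ?_⟩
  intro V c ρ χ hVs hdiv hV1 hgr hA hρ hC₀ hχ hχ01 hχout hk₁ hk₂ hk₃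
  have hρ0 : 0 < ρ := by linarith
  have hρ1 : 1 ≤ ρ := by linarith
  have hR0 : 0 < ρ ^ 8 := by positivity
  have hℓ0 : 0 < ρ ^ 7 := by positivity
  have hℓR : ρ ^ 7 ≤ ρ ^ 8 := pow_le_pow_right₀ hρ1 (by norm_num)
  have hmeas : MeasurableSet (ball c (ρ ^ 8 + ρ ^ 7) \ ball c (ρ ^ 8)) := measurableSet_ball.diff measurableSet_ball
  have hbdd : Bornology.IsBounded (ball c (ρ ^ 8 + ρ ^ 7) \ ball c (ρ ^ 8)) := isBounded_ball.subset Set.sdiff_subset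
  have hΛ2 : ball c (ρ ^ 8 + ρ ^ 7) \ ball c (ρ ^ 8) ⊆ ball c (2 * ρ ^ 8) := Set.sdiff_subset.trans (ball_subset_ball (by linarith))
  -- the gauge
  obtain ⟨hψs, -, -, -, -, hsup⟩ := gauge_pointwise (c := c) hVs hdiv hV1 hgr hAE hR0 hC₀0 hC₀
  obtain ⟨iDψ, hDψ, iDh, hDh, iD2ψ, hD2ψ⟩ := hCL V A_E c (ρ ^ 8) C₀ hVs hdiv hV1 hgr hAE hR0 hC₀0 hC₀
  obtain ⟨-, hDVle⟩ := setIntegral_norm_sq_fderiv_le_truncation (c := c) hVs hdiv hV1 hR0 hC₀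
  set ψ := biotSavart fun y => ballCutoff c (ρ ^ 8) y • V y with hψdef
  set F : E3 → ℝ := fun x => f1 V (fun y => χ y • curl ψ y - χ y • V y - curl (fun z => χ z • ψ z) y) x +
    χ x ^ 2 * (3 * sd V x - kStar * (zd V x + wd V x)) with hF
  -- (a) the layer integral lives on `Λ`
  have hzero : ∀ x ∈ (ball c (ρ ^ 8))ᶜ \ (ball c (ρ ^ 8 + ρ ^ 7) \ ball c (ρ ^ 8)), F x = 0 := by
    intro x hx
    have hx1 : x ∉ ball c (ρ ^ 8) := hx.1
    have hx2 : x ∉ ball c (ρ ^ 8 + ρ ^ 7) := fun h => hx.2 ⟨h, hx1⟩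
    rw [mem_ball, dist_eq_norm, not_lt] at hx2
    have hχx := hχout x hx2
    have hχ0 : χ x = 0 := hχx.eq_of_nhds
    have hφ : (fun y => χ y • curl ψ y - χ y • V y - curl (fun z => χ z • ψ z) y) =ᶠ[𝓝 x] fun _ => (0 : E3) := by
      filter_upwards [hχx.eventuallyEq_nhds] with y hy
      have hy0 : χ y = 0 := hy.eq_of_nhds
      have hev : (fun z => χ z • ψ z) =ᶠ[𝓝 y] fun _ => (0 : E3) := by
        filter_upwards [hy] with z hz
        rw [hz, zero_smul]
      have hc0 : curl (fun z => χ z • ψ z) y = 0 := by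
        have e : curl (fun z => χ z • ψ z) y = curl (fun _ => (0 : E3)) y := by simp only [curl, hev.fderiv_eq]
        rw [e, curl_fun_zero]
      rw [hy0, hc0, zero_smul, zero_smul, sub_zero, sub_zero]
    show f1 V _ x + χ x ^ 2 * _ = 0
    rw [f1_eq_zero_of_eventuallyEq_zero hφ, hχ0]
    ring
  have hLI : ∫ x in (ball c (ρ ^ 8))ᶜ, F x = ∫ x in ball c (ρ ^ 8 + ρ ^ 7) \ ball c (ρ ^ 8), F x :=
    setIntegral_eq_of_subset_of_forall_sdiff_eq_zero measurableSet_ball.compl (fun x hx => hx.2) hzero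
  -- (b), (c) the layer estimate
  have hL := setIntegral_abs_layerIntegrand_le (ψ := ψ) hVs hχ hψs hχ01 hA hV1 hKb1 hKbA hKbκ hKbc
    (s := (ρ ^ 4)⁻¹) (t := (ρ ^ 13)⁻¹) (by positivity) (by positivity) hmeas hbdd hk₁ hk₂ hk₃
  -- (d) the sizes
  have hNV : ∫ x in ball c (ρ ^ 8 + ρ ^ 7) \ ball c (ρ ^ 8), ‖V x‖ ^ 2 ≤ A_E * (ρ ^ 8 + ρ ^ 7) := by
    refine le_trans (setIntegral_mono_set (integrableOn_ball_of_continuous (hVs.continuous.norm.pow 2) c _)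
      (Eventually.of_forall fun x => by positivity) (Eventually.of_forall Set.sdiff_subset)) ?_
    exact hgr c _ (by positivity)
  have hNDψ : ∫ x in ball c (ρ ^ 8 + ρ ^ 7) \ ball c (ρ ^ 8), ‖fderiv ℝ ψ x‖ ^ 2 ≤ C_L * A_E * ρ ^ 8 :=
    (setIntegral_le_integral iDψ (Eventually.of_forall fun x => by positivity)).trans hDψ
  obtain ⟨Kd, hKd1, hKd2⟩ := exists_dyadic_exponent hρ1
  have hψsup : ∀ x ∈ ball c (ρ ^ 8 + ρ ^ 7) \ ball c (ρ ^ 8), ‖ψ x‖ ^ 2 ≤ (Ψ₁ * ρ) ^ 2 := by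
    intro x hx
    have h1 := hsup Kd x (hΛ2 hx) hKd1
    have hQ : 0 ≤ (A_E + 4 * Real.pi / 3) / (2 * Real.pi) := by positivity
    have h2 : ‖ψ x‖ ≤ Ψ₁ * ρ := by
      have h3 : (Kd + 1 : ℝ) * (A_E + 4 * Real.pi / 3) / (2 * Real.pi) ≤ 19 * ρ * ((A_E + 4 * Real.pi / 3) / (2 * Real.pi)) := by
        rw [mul_div_assoc]
        exact mul_le_mul_of_nonneg_right hKd2 hQ
      rw [hΨ₁]
      nlinarith [h1, h3, hQ, hρ1]
    exact pow_le_pow_left₀ (norm_nonneg _) h2 2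
  have hNψ : ∫ x in ball c (ρ ^ 8 + ρ ^ 7) \ ball c (ρ ^ 8), ‖ψ x‖ ^ 2 ≤ (Ψ₁ * ρ) ^ 2 * (32 * Real.pi / 3 * (ρ ^ 8) ^ 3) := by
    have hvol : volume (ball c (ρ ^ 8 + ρ ^ 7) \ ball c (ρ ^ 8)) < ⊤ := hbdd.measure_lt_top
    calc ∫ x in ball c (ρ ^ 8 + ρ ^ 7) \ ball c (ρ ^ 8), ‖ψ x‖ ^ 2
        ≤ ∫ x in ball c (ρ ^ 8 + ρ ^ 7) \ ball c (ρ ^ 8), (Ψ₁ * ρ) ^ 2 :=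
          setIntegral_mono_on (integrableOn_of_continuous_isBounded (hψs.continuous.norm.pow 2) hbdd)
            (integrableOn_const hvol.ne) hmeas hψsup
      _ = (Ψ₁ * ρ) ^ 2 * volume.real (ball c (ρ ^ 8 + ρ ^ 7) \ ball c (ρ ^ 8)) := by
          rw [setIntegral_const, smul_eq_mul, mul_comm]
      _ ≤ (Ψ₁ * ρ) ^ 2 * (32 * Real.pi / 3 * (ρ ^ 8) ^ 3) :=
          mul_le_mul_of_nonneg_left (volume_real_layer_le c hR0.le hℓR) (by positivity)
  have hNDV : ∫ x in ball c (ρ ^ 8 + ρ ^ 7) \ ball c (ρ ^ 8), ‖fderiv ℝ V x‖ ^ 2 ≤ C_L * (Zb V c (4 * ρ ^ 8) + C₀ ^ 2 * A_E / ρ ^ 8) := by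
    refine le_trans (setIntegral_mono_set (integrableOn_ball_of_continuous ((hVs.continuous_fderiv (by simp)).norm.pow 2) c _)
      (Eventually.of_forall fun x => by positivity) (Eventually.of_forall hΛ2)) ?_
    exact hDVle.trans hDh
  have hND2ψ : ∫ x in ball c (ρ ^ 8 + ρ ^ 7) \ ball c (ρ ^ 8), ‖iteratedFDeriv ℝ 2 ψ x‖ ^ 2 ≤
      C_L * (C_L * (Zb V c (4 * ρ ^ 8) + C₀ ^ 2 * A_E / ρ ^ 8)) :=
    ((setIntegral_le_integral iD2ψ (Eventually.of_forall fun x => by positivity)).trans hD2ψ).trans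
      (mul_le_mul_of_nonneg_left hDh hCL0)
  -- (e) the layer bulks
  have hZΛ := setIntegral_layer_zd_eq hVs c (R := ρ ^ 8) hℓ0.le
  have hWΛ := setIntegral_layer_wd_eq hVs c (R := ρ ^ 8) hℓ0.le
  have hZ0 : 0 ≤ ∫ x in ball c (ρ ^ 8 + ρ ^ 7) \ ball c (ρ ^ 8), zd V x :=
    setIntegral_nonneg hmeas fun x _ => by unfold zd; positivity
  have hW0 : 0 ≤ ∫ x in ball c (ρ ^ 8 + ρ ^ 7) \ ball c (ρ ^ 8), wd V x :=
    setIntegral_nonneg hmeas fun x _ => frobeniusNormSq_nonneg _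
  -- (f) assemble
  have hAr := layer_arith hρ hKb1 hK₁ hK₂ hK₃ hAE hCL0 hZ0 hW0 (Zb_nonneg V c (4 * ρ ^ 8)) hNV hNDψ hNψ hNDV hND2ψ
  rw [hLI]
  refine (abs_integral_le_integral_abs).trans ?_
  rw [← hZΛ.1, ← hWΛ]
  exact hL.trans hAr

end Summit.NavierStokesRegularity.NavierStokesRegularity.Theorems.NearExtremalTransiencePerFlow.TwoThirds

end
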